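import Summits.BirchSwinnertonDyer.Rank1Residual.X4.KuriharaAdditiveCertificateOfCocycle
import Summits.BirchSwinnertonDyer.Rank1Residual.X4.KuriharaAdditiveCertificateTwist
import HarnessLib

/-!
# The TWISTED additive certificate from `V`-side LEVEL-1 data / from `V`-side TWO-PRIME EXACTNESS: the families with SIGNS `w_i = a_{ℓ_i}(V)` that `X4/KuriharaAdditiveCertificateTwist.lean` transports along `W = V ⊗ χ` are generated by one `τ_q` per Kolyvagin prime, and exist as soon as the signed three-term complex is exact on an `H`-stable, `(1 − w₂[ℓ₂])`-injective part (cell `b2b-bsdres`, seat additive-p4 gen 32, line V54; the SPREAD row 298980j1 of CLASS-CLOSURE §3.1 N11)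

HONEST FRAMING (verbatim, cell `b2b-bsdres`): the goal of the cell is to DELETE the COMBINATION-SHAPED
residual classes for ALL analytic-rank `≤ 1` curves over `ℚ` — "full BSD formula for every rank `≤ 1`
curve in class `C`" assembled STRICTLY from published theorems — so that the rank-`≤ 1` remainder
becomes exactly the CONSTRUCTION-SHAPED classes, which are TYPED (missing-input Props), NOT attempted;
this is not "finishing BSD". This file: research-route KERNEL THEOREMS (pure algebra of periodic
functions; no named fact, no conjecture, nothing booked; X4 stays CONSTRUCTION-SHAPED; no Literature
fact is minted; labels unchanged; 0 defs).

## What is proved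

`X4/KuriharaAdditiveCertificateTwist.plusSymbolLevelLowersAdditivelyModAt_of_ratTwist` (gen 31, K87)
transports a `V`-side bundle — families `Dα, Dβ, τ` with the Hecke-derivative relations of
eigenvalues `a_q(V)` and the SIGNED `τ`-identities `Dα U = τ_U − w₂ τ_U∘[ℓ₂]`,
`Dβ U = −(τ_U − w₁ τ_U∘[ℓ₁])` — to the certificate of `W`. This file builds that bundle from less:

* `shiftDeriv_sub_smul_comp_natMul`, `shiftDeriv_eq_tauFamily_sub_smul` — the signed `τ`-identity at
  level `1` propagates to every level (`X4/HeckeShiftedDerivativeFamily`).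
* **`exists_families_of_cocycle`** — abstract BUNDLE: shift `a`, a set `𝒦` of primes, signs
  `w₁, w₂`, multipliers `c₁, c₂` prime to `𝒦`; periodic `α, β`, periodic `τ_q` (`q ∈ 𝒦`) with
  `E_q α = τ_q − w₂ τ_q∘[c₂]`, `E_q β = −(τ_q − w₁ τ_q∘[c₁])` and the COCYCLE condition ⟹ families
  `Dα, Dβ, τ` (all `U`) with the relations, the signed identities, `Dα ∅ = α`, `Dβ ∅ = β`.
* `heckeShift_cocycle_of_injective_smul` — the cocycle condition is automatic when the `τ_q` lie in
  an `E_q`-stable difference-closed set on which `g ↦ g − w₂ g∘[c₂]` is injective.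
* `exists_levelOne_of_exact_smul` — each `τ_q` EXISTS when the signed complex
  `z ↦ (z − w₂z∘[c₂], −(z − w₁z∘[c₁]))`, `(g, h) ↦ (g − w₁g∘[c₁]) + (h − w₂h∘[c₂])` is exact on
  `E_q`-stable sets `P₀ → P₁ × P₂` and `E_q φ = 0` for `φ = (α − w₁α∘[c₁]) + (β − w₂β∘[c₂])`.
* **`plusSymbolLevelLowersAdditivelyModAt_of_ratTwist_of_exact`** — K87 ∘ the above: the ℚ-level twist
  identity `[r]⁺_{f_W} = c₀ Σ_u ε(u) σ(r + u/m)` with `p`-integral data, the `V`-side FREE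
  decomposition of `\overline{σ}` with `α ∈ P₁`, `β ∈ P₂`, `V`-side structural data (stability,
  exactness, injectivity) and the eigen property `(H_q − a_q(V))\overline{σ} = 0` at the Kolyvagin primes
  of `W` ⟹ `PlusSymbolLevelLowersAdditivelyModAt W p f_W (p^e) ℓ₁ ℓ₂`. NO `τ` supplied. (For
  `σ = [·]^±_{f_V}` the eigen property is MTT (4.2); for the plus sign it is
  `X4/KuriharaAdditiveCertificateOfExactness.heckeShift_ratModP_ratPlusSymbol_eq_zero`.)

Per row (EVIDENCE, instrument E11 `exact2.gp` with `SIGN = ±1` on the minimal twist `V`): the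
structural data are the f-block parts of the `ℤ/p^e`-valued `±` symbols of levels `N_V/ℓ₁`, `N_V/ℓ₂`,
`N_V/ℓ₁ℓ₂` and the exactness check there; first customer the SPREAD row 298980j1 (`D = −3`, minus space).

## References

* B. Mazur, J. Tate, J. Teitelbaum, Invent. Math. 84 (1986), §I.4 (4.2), §I.8. [cite: MazurTateTeitelbaum1986Invent, §I.4 (4.2) and §I.8]
* C.-H. Kim, Amer. J. Math. 148 (2026), §1.2.2, §1.4.3. [cite: Kim2022StructureSelmer, §1.2.2 and §1.4.3]
* K. A. Ribet, Proc. ICM 1983 (1984), Thm. 4.1 (provenance of the injectivity / exactness hypotheses, not an input here). [cite: Ribet1984ICM, Thm. 4.1]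
-/

noncomputable section

open scoped MatrixGroups ModularForm

open CongruenceSubgroup Finset

open Literature.NumberTheory.EllipticCurves Literature.NumberTheory.EllipticCurves.ModularForms

open Literature.NumberTheory.DiophantineGeometry.Dioph (ratModP)

namespace Summit.BirchSwinnertonDyer.Rank1Residual.LevelLowering

/-! ### §1 Abstract bundle with signs -/

section Signed

variable {R : Type*} [CommRing R] (a : ℕ → R) {K : ℕ → Prop}

/-- `D_U (μ − w·μ∘[c]) = D_U μ − w·(D_U μ)∘[c]` (`c` prime to `U`, `μ` periodic). [folklore] -/
theorem shiftDeriv_sub_smul_comp_natMul {μ : ℚ → R} (hμ : IsPeriodic μ) {U : Finset ℕ}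
    (hU : ∀ q ∈ U, q.Prime) (w : R) {c : ℕ} (hc : ∀ q ∈ U, c.Coprime q) :
    shiftDeriv a (fun x ↦ μ x - w * μ (c * x)) U =
      fun r ↦ shiftDeriv a μ U r - w * shiftDeriv a μ U (c * r) := by
  have h1 : (fun x ↦ μ x - w * μ (c * x)) = fun x ↦ μ x - (fun y ↦ w * (fun t ↦ μ (c * t)) y) x := rfl
  rw [h1, shiftDeriv_sub, shiftDeriv_const_mul, shiftDeriv_comp_natMul a hμ hU hc]

/-- **The signed `τ`-identity propagates from level `1` to every level**: if
`E_q γ = ε·(τ_q − w·τ_q∘[c])` for every `q ∈ 𝒦`, then `D^a_U γ = ε·(τ_U − w·τ_U∘[c])` on every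
non-empty `U ⊆ 𝒦`, for the `τ`-family `τ_U = D_{U∖q₀} τ_{q₀}`. [cite: MazurTateTeitelbaum1986Invent, §I.4 (4.2)] -/
theorem shiftDeriv_eq_tauFamily_sub_smul (hK : ∀ q, K q → q.Prime) {τ₁ : ℕ → ℚ → R}
    (hτ : ∀ q, K q → IsPeriodic (τ₁ q)) (τ : Finset ℕ → ℚ → R)
    (hτdef : ∀ U q₀, (∀ q ∈ U, K q) → q₀ ∈ U → τ U = shiftDeriv a (τ₁ q₀) (U.erase q₀))
    {γ : ℚ → R} (hγ : IsPeriodic γ) {c : ℕ} (hc : ∀ q, K q → c.Coprime q) (ε w : R)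
    (h1 : ∀ q, K q → heckeShift a q γ = fun r ↦ ε * (τ₁ q r - w * τ₁ q (c * r)))
    {U : Finset ℕ} (hne : U.Nonempty) (hU : ∀ q ∈ U, K q) (r : ℚ) :
    shiftDeriv a γ U r = ε * (τ U r - w * τ U (c * r)) := by
  obtain ⟨q₀, h₀⟩ := hne
  have hVK : ∀ x ∈ U.erase q₀, x.Prime := fun x hx ↦ hK x (hU x (Finset.mem_of_mem_erase hx))
  have hVc : ∀ x ∈ U.erase q₀, c.Coprime x := fun x hx ↦ hc x (hU x (Finset.mem_of_mem_erase hx))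
  have hq0V : q₀ ∉ U.erase q₀ := fun h ↦ by simp at h
  rw [hτdef U q₀ hU h₀]
  conv_lhs => rw [← Finset.insert_erase h₀]
  rw [← shiftDeriv_heckeShift a hγ hVK (hK q₀ (hU q₀ h₀)) hq0V, h1 q₀ (hU q₀ h₀)]
  have hfun : (fun r ↦ ε * (τ₁ q₀ r - w * τ₁ q₀ (c * r))) =
      fun r ↦ ε * (fun x ↦ τ₁ q₀ x - w * τ₁ q₀ (c * x)) r := rfl
  rw [hfun, shiftDeriv_const_mul, shiftDeriv_sub_smul_comp_natMul a (hτ q₀ (hU q₀ h₀)) hVK w hVc]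

/-- **THE SIGNED BUNDLE FROM LEVEL-1 DATA + THE COCYCLE CONDITION.** Shift `a`, primes `𝒦`, signs
`w₁, w₂`, multipliers `c₁, c₂` prime to `𝒦`; periodic `α, β`; periodic `τ_q` (`q ∈ 𝒦`) with
`E_q α = τ_q − w₂ τ_q∘[c₂]`, `E_q β = −(τ_q − w₁ τ_q∘[c₁])`, and `E_q τ_{q'} = E_{q'} τ_q`. Then there
are families `Dα, Dβ, τ : Finset ℕ → (ℚ → R)`, all periodic, with `H_q (D U) = a_q D U + D(U∪q)`
(`q ∈ 𝒦 ∖ U`; for `τ` on `U ≠ ∅`), the signed identities on the non-empty `𝒦`-sets, `Dα ∅ = α`,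
`Dβ ∅ = β` — the `V`-side hypothesis bundle of
`X4/KuriharaAdditiveCertificateTwist.plusSymbolLevelLowersAdditivelyModAt_of_twistSum_fn / _of_ratTwist`.
[cite: MazurTateTeitelbaum1986Invent, §I.4 (4.2)] [cite: Kim2022StructureSelmer, §1.4.3] -/
theorem exists_families_of_cocycle (hK : ∀ q, K q → q.Prime) (w₁ w₂ : R) {c₁ c₂ : ℕ}
    (hc₁ : ∀ q, K q → c₁.Coprime q) (hc₂ : ∀ q, K q → c₂.Coprime q)
    {α β : ℚ → R} (hα : IsPeriodic α) (hβ : IsPeriodic β)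
    (τ₁ : ℕ → ℚ → R) (hτ : ∀ q, K q → IsPeriodic (τ₁ q))
    (h1 : ∀ q, K q → heckeShift a q α = fun r ↦ τ₁ q r - w₂ * τ₁ q (c₂ * r))
    (h2 : ∀ q, K q → heckeShift a q β = fun r ↦ -(τ₁ q r - w₁ * τ₁ q (c₁ * r)))
    (hcoc : ∀ q q', K q → K q' → q ≠ q' → heckeShift a q (τ₁ q') = heckeShift a q' (τ₁ q)) :
    ∃ Dα Dβ τ : Finset ℕ → ℚ → R,
      (∀ U, IsPeriodic (Dα U)) ∧ (∀ U, IsPeriodic (Dβ U)) ∧ (∀ U, IsPeriodic (τ U)) ∧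
      (∀ (U : Finset ℕ) (q : ℕ), K q → q ∉ U → ∀ r : ℚ,
        heckeTransform q (Dα U) r = a q * Dα U r + Dα (insert q U) r) ∧
      (∀ (U : Finset ℕ) (q : ℕ), K q → q ∉ U → ∀ r : ℚ,
        heckeTransform q (Dβ U) r = a q * Dβ U r + Dβ (insert q U) r) ∧
      (∀ (U : Finset ℕ), U.Nonempty → ∀ (q : ℕ), K q → q ∉ U → ∀ r : ℚ,
        heckeTransform q (τ U) r = a q * τ U r + τ (insert q U) r) ∧
      (∀ U : Finset ℕ, U.Nonempty → (∀ q ∈ U, K q) → ∀ r : ℚ, Dα U r = τ U r - w₂ * τ U (c₂ * r)) ∧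
      (∀ U : Finset ℕ, U.Nonempty → (∀ q ∈ U, K q) →
        ∀ r : ℚ, Dβ U r = -(τ U r - w₁ * τ U (c₁ * r))) ∧
      Dα ∅ = α ∧ Dβ ∅ = β := by
  classical
  let Dα : Finset ℕ → ℚ → R := fun U ↦ if ∀ q ∈ U, K q then shiftDeriv a α U else fun _ ↦ 0
  let Dβ : Finset ℕ → ℚ → R := fun U ↦ if ∀ q ∈ U, K q then shiftDeriv a β U else fun _ ↦ 0
  let τ : Finset ℕ → ℚ → R := fun U ↦
    if h : U.Nonempty ∧ ∀ q ∈ U, K q then shiftDeriv a (τ₁ (U.min' h.1)) (U.erase (U.min' h.1))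
    else fun _ ↦ 0
  have hDα : ∀ U, (∀ q ∈ U, K q) → Dα U = shiftDeriv a α U := fun U hU ↦ if_pos hU
  have hDα0 : ∀ U, ¬ (∀ q ∈ U, K q) → Dα U = fun _ ↦ 0 := fun U hU ↦ if_neg hU
  have hDβ : ∀ U, (∀ q ∈ U, K q) → Dβ U = shiftDeriv a β U := fun U hU ↦ if_pos hU
  have hDβ0 : ∀ U, ¬ (∀ q ∈ U, K q) → Dβ U = fun _ ↦ 0 := fun U hU ↦ if_neg hU
  have hτdef : ∀ U q₀, (∀ q ∈ U, K q) → q₀ ∈ U → τ U = shiftDeriv a (τ₁ q₀) (U.erase q₀) := by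
    intro U q₀ hU h₀
    have h : U.Nonempty ∧ ∀ q ∈ U, K q := ⟨⟨q₀, h₀⟩, hU⟩
    show (if h : U.Nonempty ∧ ∀ q ∈ U, K q then
      shiftDeriv a (τ₁ (U.min' h.1)) (U.erase (U.min' h.1)) else fun _ ↦ 0) = _
    rw [dif_pos h]
    exact shiftDeriv_erase_eq_of_cocycle a hK hτ hcoc hU (Finset.min'_mem U h.1) h₀
  have hτ0 : ∀ U : Finset ℕ, ¬ (U.Nonempty ∧ ∀ q ∈ U, K q) → τ U = fun _ ↦ 0 :=
    fun U hU ↦ dif_neg hU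
  refine ⟨Dα, Dβ, τ, isPeriodic_familyK a hK hα Dα hDα hDα0, isPeriodic_familyK a hK hβ Dβ hDβ hDβ0,
    isPeriodic_tauFamily a hK hτ τ hτdef hτ0, ?_, ?_, ?_, ?_, ?_, ?_, ?_⟩
  · intro U q hq hqU r
    exact heckeTransform_familyK a hK hα Dα hDα hDα0 U hq hqU r
  · intro U q hq hqU r
    exact heckeTransform_familyK a hK hβ Dβ hDβ hDβ0 U hq hqU r
  · intro U hne q hq hqU r
    exact heckeTransform_tauFamily a hK hτ τ hτdef hτ0 hne hq hqU r
  · intro U hne hU r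
    rw [hDα U hU]
    have := shiftDeriv_eq_tauFamily_sub_smul a hK hτ τ hτdef hα hc₂ 1 w₂
      (fun q hq ↦ by rw [h1 q hq]; funext r; ring) hne hU r
    rw [this, one_mul]
  · intro U hne hU r
    rw [hDβ U hU]
    have := shiftDeriv_eq_tauFamily_sub_smul a hK hτ τ hτdef hβ hc₁ (-1) w₁
      (fun q hq ↦ by rw [h2 q hq]; funext r; ring) hne hU r
    rw [this]
    ring
  · rw [hDα ∅ (by simp), shiftDeriv_empty]
  · rw [hDβ ∅ (by simp), shiftDeriv_empty]

/-- **The cocycle condition is automatic under injectivity of `g ↦ g − w·g∘[c]`** on an `E_q`-stable,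
difference-closed set `P₀` of periodic functions containing the `τ_q`, when
`E_q α = τ_q − w·τ_q∘[c]` (`q ∈ 𝒦`). [cite: MazurTateTeitelbaum1986Invent, §I.4 (4.2)] [cite: Ribet1984ICM, Thm. 4.1] -/
theorem heckeShift_cocycle_of_injective_smul (hK : ∀ q, K q → q.Prime) {P₀ : Set (ℚ → R)}
    (hP : ∀ g ∈ P₀, IsPeriodic g)
    (hsub : ∀ g ∈ P₀, ∀ h ∈ P₀, (fun r ↦ g r - h r) ∈ P₀)
    (hE : ∀ q, K q → ∀ g ∈ P₀, heckeShift a q g ∈ P₀)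
    (w : R) {c : ℕ} (hc : ∀ q, K q → c.Coprime q)
    (hinj : ∀ g ∈ P₀, (∀ r, g r - w * g (c * r) = 0) → g = fun _ ↦ 0)
    {τ₁ : ℕ → ℚ → R} (hτP : ∀ q, K q → τ₁ q ∈ P₀) {α : ℚ → R} (hα : IsPeriodic α)
    (h1 : ∀ q, K q → heckeShift a q α = fun r ↦ τ₁ q r - w * τ₁ q (c * r)) :
    ∀ q q', K q → K q' → q ≠ q' → heckeShift a q (τ₁ q') = heckeShift a q' (τ₁ q) := by
  intro q q' hq hq' hne
  have hτq : IsPeriodic (τ₁ q) := hP _ (hτP q hq)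
  have hτq' : IsPeriodic (τ₁ q') := hP _ (hτP q' hq')
  set g : ℚ → R := fun r ↦ heckeShift a q (τ₁ q') r - heckeShift a q' (τ₁ q) r with hg
  have hgP : g ∈ P₀ := hsub _ (hE q hq _ (hτP q' hq')) _ (hE q' hq' _ (hτP q hq))
  have hzero : g = fun _ ↦ 0 := by
    refine hinj g hgP fun r ↦ ?_
    have hA' : (fun r ↦ heckeShift a q (τ₁ q') r - w * heckeShift a q (τ₁ q') (c * r)) =
        heckeShift a q (heckeShift a q' α) := by
      rw [h1 q' hq', show (fun r ↦ τ₁ q' r - w * τ₁ q' (c * r)) =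
          fun r ↦ τ₁ q' r - (fun y ↦ w * (fun t ↦ τ₁ q' (c * t)) y) r from rfl, heckeShift_sub,
        heckeShift_const_mul, heckeShift_comp_natMul a hτq' (hK q hq) (hc q hq)]
    have hB' : (fun r ↦ heckeShift a q' (τ₁ q) r - w * heckeShift a q' (τ₁ q) (c * r)) =
        heckeShift a q' (heckeShift a q α) := by
      rw [h1 q hq, show (fun r ↦ τ₁ q r - w * τ₁ q (c * r)) =
          fun r ↦ τ₁ q r - (fun y ↦ w * (fun t ↦ τ₁ q (c * t)) y) r from rfl, heckeShift_sub,
        heckeShift_const_mul, heckeShift_comp_natMul a hτq (hK q' hq') (hc q' hq')]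
    have hA := congrFun hA' r
    have hB := congrFun hB' r
    have hcomm := congrFun (heckeShift_comm a hα (hK q hq) (hK q' hq') hne) r
    simp only [hg]
    calc heckeShift a q (τ₁ q') r - heckeShift a q' (τ₁ q) r -
          w * (heckeShift a q (τ₁ q') (c * r) - heckeShift a q' (τ₁ q) (c * r))
        = (heckeShift a q (τ₁ q') r - w * heckeShift a q (τ₁ q') (c * r)) -
            (heckeShift a q' (τ₁ q) r - w * heckeShift a q' (τ₁ q) (c * r)) := by ring
      _ = 0 := by rw [hA, hB, hcomm, sub_self]
  funext r
  have := congrFun hzero r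
  simp only [hg] at this
  exact sub_eq_zero.mp this

/-- **EXISTENCE OF THE SIGNED `τ_q` FROM EXACTNESS** of
`z ↦ (z − w₂z∘[c₂], −(z − w₁z∘[c₁])) : P₀ → {(g, h) ∈ P₁ × P₂ : (g − w₁g∘[c₁]) + (h − w₂h∘[c₂]) = 0}`,
given `E_q φ = 0` for `φ = (α − w₁α∘[c₁]) + (β − w₂β∘[c₂])`.
[cite: MazurTateTeitelbaum1986Invent, §I.4 (4.2)] -/
theorem exists_levelOne_of_exact_smul (hK : ∀ q, K q → q.Prime) {P₁ P₂ P₀ : Set (ℚ → R)}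
    (hE₁ : ∀ q, K q → ∀ g ∈ P₁, heckeShift a q g ∈ P₁)
    (hE₂ : ∀ q, K q → ∀ g ∈ P₂, heckeShift a q g ∈ P₂)
    (w₁ w₂ : R) {c₁ c₂ : ℕ} (hc₁ : ∀ q, K q → c₁.Coprime q) (hc₂ : ∀ q, K q → c₂.Coprime q)
    (hexact : ∀ g ∈ P₁, ∀ h ∈ P₂,
      (∀ r, (g r - w₁ * g (c₁ * r)) + (h r - w₂ * h (c₂ * r)) = 0) →
      ∃ z ∈ P₀, (g = fun r ↦ z r - w₂ * z (c₂ * r)) ∧ (h = fun r ↦ -(z r - w₁ * z (c₁ * r))))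
    {α β : ℚ → R} (hα : IsPeriodic α) (hβ : IsPeriodic β) (hαP : α ∈ P₁) (hβP : β ∈ P₂)
    {φ : ℚ → R} (hsym : ∀ r, φ r = (α r - w₁ * α (c₁ * r)) + (β r - w₂ * β (c₂ * r)))
    {q : ℕ} (hq : K q) (heig : heckeShift a q φ = fun _ ↦ 0) :
    ∃ z ∈ P₀, (heckeShift a q α = fun r ↦ z r - w₂ * z (c₂ * r)) ∧
      (heckeShift a q β = fun r ↦ -(z r - w₁ * z (c₁ * r))) := by
  refine hexact _ (hE₁ q hq α hαP) _ (hE₂ q hq β hβP) fun r ↦ ?_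
  have hφ : φ = fun r ↦ (fun x ↦ α x - w₁ * α (c₁ * x)) r + (fun x ↦ β x - w₂ * β (c₂ * x)) r := by
    funext r; exact hsym r
  have h1 := congrFun (shiftDeriv_sub_smul_comp_natMul a hα (U := {q}) (by simpa using hK q hq)
    w₁ (c := c₁) (by simpa using hc₁ q hq)) r
  have h2 := congrFun (shiftDeriv_sub_smul_comp_natMul a hβ (U := {q}) (by simpa using hK q hq)
    w₂ (c := c₂) (by simpa using hc₂ q hq)) r
  have hsing : ∀ γ : ℚ → R, shiftDeriv a γ {q} = heckeShift a q γ := by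
    intro γ
    simp [shiftDeriv, shiftDerivList]
  rw [hsing, hsing] at h1 h2
  have h0 := congrFun heig r
  rw [hφ, heckeShift_add] at h0
  simp only at h0
  rw [← h1, ← h2]
  exact h0

/-- **THE SIGNED BUNDLE FROM THE FREE DECOMPOSITION + EXACTNESS** (no `τ` supplied): the three
theorems combined. [cite: MazurTateTeitelbaum1986Invent, §I.4 (4.2)] [cite: Ribet1984ICM, Thm. 4.1] -/
theorem exists_families_of_exact (hK : ∀ q, K q → q.Prime) (w₁ w₂ : R) {c₁ c₂ : ℕ}
    (hc₁ : ∀ q, K q → c₁.Coprime q) (hc₂ : ∀ q, K q → c₂.Coprime q)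
    {α β : ℚ → R} (hα : IsPeriodic α) (hβ : IsPeriodic β)
    {P₁ P₂ P₀ : Set (ℚ → R)} (hαP : α ∈ P₁) (hβP : β ∈ P₂)
    (hE₁ : ∀ q, K q → ∀ g ∈ P₁, heckeShift a q g ∈ P₁)
    (hE₂ : ∀ q, K q → ∀ g ∈ P₂, heckeShift a q g ∈ P₂)
    (hP₀ : ∀ g ∈ P₀, IsPeriodic g)
    (hsub₀ : ∀ g ∈ P₀, ∀ h ∈ P₀, (fun r ↦ g r - h r) ∈ P₀)
    (hE₀ : ∀ q, K q → ∀ g ∈ P₀, heckeShift a q g ∈ P₀)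
    (hinj₀ : ∀ g ∈ P₀, (∀ r, g r - w₂ * g (c₂ * r) = 0) → g = fun _ ↦ 0)
    (hexact : ∀ g ∈ P₁, ∀ h ∈ P₂,
      (∀ r, (g r - w₁ * g (c₁ * r)) + (h r - w₂ * h (c₂ * r)) = 0) →
      ∃ z ∈ P₀, (g = fun r ↦ z r - w₂ * z (c₂ * r)) ∧ (h = fun r ↦ -(z r - w₁ * z (c₁ * r))))
    {φ : ℚ → R} (hsym : ∀ r, φ r = (α r - w₁ * α (c₁ * r)) + (β r - w₂ * β (c₂ * r)))
    (heig : ∀ q, K q → heckeShift a q φ = fun _ ↦ 0) :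
    ∃ Dα Dβ τ : Finset ℕ → ℚ → R,
      (∀ U, IsPeriodic (Dα U)) ∧ (∀ U, IsPeriodic (Dβ U)) ∧ (∀ U, IsPeriodic (τ U)) ∧
      (∀ (U : Finset ℕ) (q : ℕ), K q → q ∉ U → ∀ r : ℚ,
        heckeTransform q (Dα U) r = a q * Dα U r + Dα (insert q U) r) ∧
      (∀ (U : Finset ℕ) (q : ℕ), K q → q ∉ U → ∀ r : ℚ,
        heckeTransform q (Dβ U) r = a q * Dβ U r + Dβ (insert q U) r) ∧
      (∀ (U : Finset ℕ), U.Nonempty → ∀ (q : ℕ), K q → q ∉ U → ∀ r : ℚ,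
        heckeTransform q (τ U) r = a q * τ U r + τ (insert q U) r) ∧
      (∀ U : Finset ℕ, U.Nonempty → (∀ q ∈ U, K q) → ∀ r : ℚ, Dα U r = τ U r - w₂ * τ U (c₂ * r)) ∧
      (∀ U : Finset ℕ, U.Nonempty → (∀ q ∈ U, K q) →
        ∀ r : ℚ, Dβ U r = -(τ U r - w₁ * τ U (c₁ * r))) ∧
      Dα ∅ = α ∧ Dβ ∅ = β := by
  classical
  have hex : ∀ q, K q → ∃ z ∈ P₀, (heckeShift a q α = fun r ↦ z r - w₂ * z (c₂ * r)) ∧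
      (heckeShift a q β = fun r ↦ -(z r - w₁ * z (c₁ * r))) :=
    fun q hq ↦ exists_levelOne_of_exact_smul a hK hE₁ hE₂ w₁ w₂ hc₁ hc₂ hexact hα hβ hαP hβP hsym hq
      (heig q hq)
  let τ₁ : ℕ → ℚ → R := fun q ↦ if hq : K q then (hex q hq).choose else fun _ ↦ 0
  have hτ₁ : ∀ q (hq : K q), τ₁ q = (hex q hq).choose := fun q hq ↦ dif_pos hq
  have hτP : ∀ q, K q → τ₁ q ∈ P₀ := fun q hq ↦ by rw [hτ₁ q hq]; exact (hex q hq).choose_spec.1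
  have h1 : ∀ q, K q → heckeShift a q α = fun r ↦ τ₁ q r - w₂ * τ₁ q (c₂ * r) :=
    fun q hq ↦ by rw [hτ₁ q hq]; exact (hex q hq).choose_spec.2.1
  have h2 : ∀ q, K q → heckeShift a q β = fun r ↦ -(τ₁ q r - w₁ * τ₁ q (c₁ * r)) :=
    fun q hq ↦ by rw [hτ₁ q hq]; exact (hex q hq).choose_spec.2.2
  exact exists_families_of_cocycle a hK w₁ w₂ hc₁ hc₂ hα hβ τ₁ (fun q hq ↦ hP₀ _ (hτP q hq)) h1 h2
    (heckeShift_cocycle_of_injective_smul a hK hP₀ hsub₀ hE₀ w₂ hc₂ hinj₀ hτP hα h1)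

end Signed

/-! ### §2 The twisted certificate of `W` from `V`-side exactness -/

section Twist

variable {p : ℕ} [hp : Fact p.Prime]

/-- **THE ADDITIVE CERTIFICATE OF `W = V ⊗ χ` FROM THE `V`-SIDE FREE DECOMPOSITION + `V`-SIDE
TWO-PRIME EXACTNESS** — `X4/KuriharaAdditiveCertificateTwist.plusSymbolLevelLowersAdditivelyModAt_of_ratTwist`
with its `V`-side bundle produced by `exists_families_of_exact`. Data: the ℚ-level twist identity
`[r]⁺_{f_W} = c₀ Σ_u ε(u) σ(r + u/m)` (`p`-integral `c₀`, `σ`; `ε` lifts `χ`); the FREE decomposition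
`\overline{σ} = (α − w₁α∘[ℓ₁]) + (β − w₂β∘[ℓ₂])` with `α ∈ P₁`, `β ∈ P₂` (`w_i` = the `U_{ℓ_i}`-signs of
`f_V`); `P₁, P₂, P₀` stable under `E_q = H_q − a_q(V)` at the Kolyvagin primes of `(W, p)`, `P₀`
difference-closed with `g ↦ g − w₂ g∘[ℓ₂]` injective, EXACTNESS of the signed complex; the eigen
property `E_q \overline{σ} = 0`; `ℓ_i ∣ N_W`, `ℓ_i` invertible mod `m` with `χ(ℓ_i)² = 1`,
`w_iχ(ℓ_i) = 1`; `q` invertible mod `m`, `χ(q)² = 1`, `a_q(W) = χ(q)a_q(V)` at the Kolyvagin primes. Then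
`PlusSymbolLevelLowersAdditivelyModAt W p f_W (p^e) ℓ₁ ℓ₂` — NO `τ` supplied.
[cite: Kim2022StructureSelmer, §1.2.2 and §1.4.3] [cite: MazurTateTeitelbaum1986Invent, §I.4 (4.2) and §I.8]
[cite: Ribet1984ICM, Thm. 4.1] -/
theorem plusSymbolLevelLowersAdditivelyModAt_of_ratTwist_of_exact (W V : WeierstrassCurve ℚ)
    [W.IsGloballyMinimal] [V.IsGloballyMinimal] {e : ℕ} {m : ℕ} [NeZero m]
    (χ : ZMod m →* ZMod (p ^ e)) (ε : ZMod m → ℤ)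
    (hε : ∀ u : ZMod m, ((ε u : ℤ) : ZMod (p ^ e)) = χ u)
    {NW : ℕ} (fW : CuspForm (Gamma0 NW) 2) (σ : ℚ → ℚ)
    (c₀ : ℚ) (hc : ¬ p ∣ c₀.den) (hint : ∀ x : ℚ, ¬ p ∣ (σ x).den)
    (hsym : ∀ r : ℚ, ratPlusSymbol fW r =
      c₀ * ∑ u : ZMod m, (ε u : ℚ) * σ (r + (u.val : ℚ) / m))
    {ℓ₁ ℓ₂ : ℕ} (hℓ₁N : ℓ₁ ∣ W.conductorNorm ℤ) (hℓ₂N : ℓ₂ ∣ W.conductorNorm ℤ)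
    {w₁ w₂ : ZMod (p ^ e)}
    {α β : ℚ → ZMod (p ^ e)} (hα : IsPeriodic α) (hβ : IsPeriodic β)
    {P₁ P₂ P₀ : Set (ℚ → ZMod (p ^ e))} (hαP : α ∈ P₁) (hβP : β ∈ P₂)
    (hE₁ : ∀ q, Kato.IsKolyvaginPrime W p 1 q → ∀ g ∈ P₁,
      heckeShift (fun q ↦ (V.frobeniusTrace q : ZMod (p ^ e))) q g ∈ P₁)
    (hE₂ : ∀ q, Kato.IsKolyvaginPrime W p 1 q → ∀ g ∈ P₂,
      heckeShift (fun q ↦ (V.frobeniusTrace q : ZMod (p ^ e))) q g ∈ P₂)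
    (hP₀ : ∀ g ∈ P₀, IsPeriodic g)
    (hsub₀ : ∀ g ∈ P₀, ∀ h ∈ P₀, (fun r ↦ g r - h r) ∈ P₀)
    (hE₀ : ∀ q, Kato.IsKolyvaginPrime W p 1 q → ∀ g ∈ P₀,
      heckeShift (fun q ↦ (V.frobeniusTrace q : ZMod (p ^ e))) q g ∈ P₀)
    (hinj₀ : ∀ g ∈ P₀, (∀ r, g r - w₂ * g (ℓ₂ * r) = 0) → g = fun _ ↦ 0)
    (hexact : ∀ g ∈ P₁, ∀ h ∈ P₂,
      (∀ r, (g r - w₁ * g (ℓ₁ * r)) + (h r - w₂ * h (ℓ₂ * r)) = 0) →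
      ∃ z ∈ P₀, (g = fun r ↦ z r - w₂ * z (ℓ₂ * r)) ∧ (h = fun r ↦ -(z r - w₁ * z (ℓ₁ * r))))
    (hV : ∀ r : ℚ, ratModP (p ^ e) (σ r) = (α r - w₁ * α (ℓ₁ * r)) + (β r - w₂ * β (ℓ₂ * r)))
    (heig : ∀ q, Kato.IsKolyvaginPrime W p 1 q →
      heckeShift (fun q ↦ (V.frobeniusTrace q : ZMod (p ^ e))) q
        (fun r ↦ ratModP (p ^ e) (σ r)) = fun _ ↦ 0)
    (hℓ₁ : IsUnit ((ℓ₁ : ℕ) : ZMod m) ∧ χ ℓ₁ ^ 2 = 1 ∧ w₁ * χ ℓ₁ = 1)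
    (hℓ₂ : IsUnit ((ℓ₂ : ℕ) : ZMod m) ∧ χ ℓ₂ ^ 2 = 1 ∧ w₂ * χ ℓ₂ = 1)
    (hunit : ∀ q : ℕ, Kato.IsKolyvaginPrime W p 1 q → IsUnit ((q : ℕ) : ZMod m) ∧ χ q ^ 2 = 1)
    (haq : ∀ q : ℕ, Kato.IsKolyvaginPrime W p 1 q →
      (W.frobeniusTrace q : ZMod (p ^ e)) = χ q * V.frobeniusTrace q) :
    PlusSymbolLevelLowersAdditivelyModAt W p fW (p ^ e) ℓ₁ ℓ₂ := by
  obtain ⟨Dα, Dβ, τ, hpα, hpβ, hpτ, hDα, hDβ, hDτ, h1, h2, hα0, hβ0⟩ :=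
    exists_families_of_exact (fun q ↦ (V.frobeniusTrace q : ZMod (p ^ e)))
      (K := fun q ↦ Kato.IsKolyvaginPrime W p 1 q) (fun _ hq ↦ hq.prime) w₁ w₂
      (fun _ hq ↦ coprime_of_isKolyvaginPrime_of_dvd hℓ₁N hq)
      (fun _ hq ↦ coprime_of_isKolyvaginPrime_of_dvd hℓ₂N hq)
      hα hβ hαP hβP hE₁ hE₂ hP₀ hsub₀ hE₀ hinj₀ hexact hV heig
  refine plusSymbolLevelLowersAdditivelyModAt_of_ratTwist W V χ ε hε fW σ c₀ hc hint hsym Dα Dβ τ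
    hpα hpβ hpτ hDα hDβ hDτ h1 h2 (fun r ↦ ?_) hℓ₁ hℓ₂ hunit haq
  rw [hα0, hβ0]
  exact hV r

end Twist

end Summit.BirchSwinnertonDyer.Rank1Residual.LevelLowering

end
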